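import Mathlib
import Literature.NumberTheory.Automorphic.HilbertModularFormQExpansion

/-!
# Crux `HilbertIntegralOverconvergentIsCongruence` (stmt-Langlands-8485), line `Sketch-ideate-r1-k1`,
# section L: stub `stub_bounded_of_coeff_support` (L6)

Section L of the line proves the Fourier expansion `f(z) = ∑_{ν ∈ 𝔡⁻¹} a_ν e^{2πi S(νz)}` of a
holomorphic `𝓞 F`-periodic function on the tube domain (absolutely convergent) and Götzky–Koecher
(`a_ν = 0` unless `ν = 0` or `ν ≫ 0`).  This file proves the registered stub turning these two facts
into the vocabulary's cusp condition `HilbertModular.IsBoundedAtInfty` (Freitag, *Hilbert Modular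
Forms*, I.4.3): with `A = 1` and `C = ∑_ν |a_ν| e^{-2π ∑_σ σ(ν)}` (the majorant series at height
`y = (1, …, 1)`), for `z ∈ ℍ` with `Im z_σ ≥ 1` one has termwise
`|a_ν e^{2πi S(νz)}| = |a_ν| e^{-2π ∑_σ σ(ν) Im z_σ} ≤ |a_ν| e^{-2π ∑_σ σ(ν)}` (trivial if `a_ν = 0`;
otherwise `ν = 0` or `σ(ν) > 0` for all `σ`), whence `|f(z)| ≤ C` by `HasSum.norm_le_of_bounded`.
-/

set_option linter.dupNamespace false

noncomputable section

namespace Summit.Langlands.Langlands.Theorems.HilbertIntegralOverconvergentIsCongruence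

open MeasureTheory Complex NumberField
open Literature.NumberTheory.Automorphic Literature.NumberTheory.Automorphic.HilbertModular

/-- The imaginary part of the pairing: `Im S(νz) = ∑_σ σ(ν) Im z_σ` (the `σ(ν)` are real). -/
theorem bcs_im_pairing {F : Type} [Field F] [NumberField F] (ν : F) (z : Point F) :
    (pairing ν z).im = ∑ σ : F →+* ℝ, σ ν * (z σ).im := by
  rw [pairing, Complex.im_sum]
  exact Finset.sum_congr rfl fun σ _ ↦ Complex.im_ofReal_mul _ _

/-- The real part of the phase: `Re (2πi S(νz)) = -2π ∑_σ σ(ν) Im z_σ`. -/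
theorem bcs_re_phase {F : Type} [Field F] [NumberField F] (ν : F) (z : Point F) :
    (2 * Real.pi * I * pairing ν z).re = -(2 * Real.pi * ∑ σ : F →+* ℝ, σ ν * (z σ).im) := by
  rw [← bcs_im_pairing]
  simp [Complex.mul_re]

/-- The size of a `q`-monomial term: `|a e^{2πi S(νz)}| = |a| e^{-2π ∑_σ σ(ν) Im z_σ}`. -/
theorem bcs_norm_term {F : Type} [Field F] [NumberField F] (a : ℂ) (ν : F) (z : Point F) :
    ‖a * cexp (2 * Real.pi * I * pairing ν z)‖ =
      ‖a‖ * Real.exp (-(2 * Real.pi * ∑ σ : F →+* ℝ, σ ν * (z σ).im)) := by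
  rw [norm_mul, Complex.norm_exp, bcs_re_phase]

/-- Termwise majorant: if the non-zero coefficients sit at `ν = 0` or `ν ≫ 0`, then at any point `z`
with `Im z_σ ≥ y_σ` for all `σ` the `ν`-th term is bounded by the majorant at height `y`,
`|a_ν e^{2πi S(νz)}| ≤ |a_ν| e^{-2π ∑_σ σ(ν) y_σ}`. -/
theorem bcs_term_le {F : Type} [Field F] [NumberField F] {S : Set F} {a : F → ℂ}
    (hS : ∀ ν ∈ S, a ν ≠ 0 → ν = 0 ∨ ∀ σ : F →+* ℝ, 0 < σ ν)
    (y : (F →+* ℝ) → ℝ) {z : Point F} (hA : ∀ σ, y σ ≤ (z σ).im) (ν : S) :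
    ‖a ν * cexp (2 * Real.pi * I * pairing (ν : F) z)‖ ≤
      ‖a ν‖ * Real.exp (-(2 * Real.pi * ∑ σ : F →+* ℝ, σ (ν : F) * y σ)) := by
  rw [bcs_norm_term]
  by_cases ha : a ν = 0
  · simp [ha]
  refine mul_le_mul_of_nonneg_left (Real.exp_le_exp.2 (neg_le_neg ?_)) (norm_nonneg _)
  refine mul_le_mul_of_nonneg_left (Finset.sum_le_sum fun σ _ ↦ ?_) (by positivity)
  rcases hS ν ν.2 ha with h0 | hpos
  · simp [h0]
  · exact mul_le_mul_of_nonneg_left (hA σ) (hpos σ).le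

/-- **Stub L6 — `stub_bounded_of_coeff_support`.** A function on `ℍ` that is the sum of an absolutely
convergent `q`-series `∑_{ν ∈ S} a_ν e^{2πi S(νz)}` whose non-zero coefficients sit at `ν = 0` or `ν ≫ 0`
is bounded at `∞`: for `Im z_σ ≥ 1`, `|f(z)| ≤ ∑ |a_ν| e^{-2π⟨ν, Im z⟩} ≤ ∑ |a_ν| e^{-2π⟨ν, 1⟩}`
(Freitag, *Hilbert Modular Forms*, Ch. I Def. 4.3). -/
theorem stub_bounded_of_coeff_support (F : Type) [Field F] [NumberField F] (f : Point F → ℂ) (S : Set F)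
    (a : F → ℂ) (hS : ∀ ν ∈ S, a ν ≠ 0 → ν = 0 ∨ ∀ σ : F →+* ℝ, 0 < σ ν)
    (hsum : ∀ z ∈ halfSpace F, HasSum (fun ν : S ↦ a ν * cexp (2 * Real.pi * I * pairing (ν : F) z)) (f z))
    (habs : ∀ y : (F →+* ℝ) → ℝ, (∀ σ, 0 < y σ) →
      Summable (fun ν : S ↦ ‖a ν‖ * Real.exp (-(2 * Real.pi * ∑ σ : F →+* ℝ, σ (ν : F) * y σ)))) :
    IsBoundedAtInfty F f := by
  refine ⟨∑' ν : S, ‖a ν‖ * Real.exp (-(2 * Real.pi * ∑ σ : F →+* ℝ, σ (ν : F) * (1 : ℝ))), 1,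
    fun z hz hA ↦ ?_⟩
  exact (hsum z hz).norm_le_of_bounded (habs (fun _ ↦ 1) fun _ ↦ one_pos).hasSum
    fun ν ↦ bcs_term_le hS (fun _ ↦ 1) hA ν

end Summit.Langlands.Langlands.Theorems.HilbertIntegralOverconvergentIsCongruence
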